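import Mathlib
import HarnessLib
import Literature.MathematicalPhysics.QuantumLattice.KohnLuttinger
import Literature.Analysis.OperatorTheory.PositivityImproving
import Literature.Analysis.OperatorTheory.L2KernelIntegralOperator
import Summits.HubbardSuperconductivity.HubbardSuperconductivity.Theorems.ChiralWindowCwKLChiralWindowKernelHS
import Summits.HubbardSuperconductivity.HubbardSuperconductivity.Theorems.ChiralWindowCwKLChiralWindowD4Invariant
import Summits.HubbardSuperconductivity.HubbardSuperconductivity.Theorems.ChiralWindowCwKLChiralWindowGradient
import Summits.HubbardSuperconductivity.HubbardSuperconductivity.Theorems.ChiralWindowCwKLChiralWindowFiniteMeasure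
import Summits.HubbardSuperconductivity.HubbardSuperconductivity.Theorems.ChiralWindowCwKLChiralWindowHausdorffFinite
import Summits.HubbardSuperconductivity.HubbardSuperconductivity.Theorems.ChiralWindowCwKLChiralWindowD4Unitary
import Summits.HubbardSuperconductivity.HubbardSuperconductivity.Theorems.ChiralWindowCwKLChiralWindowSectorProj

/-!
# `stub_klSectorKernel`: sector kernels of the Kohn–Luttinger operator

Crux `CwKLChiralWindow` (stmt-HubbardSuperconductivity-1741), line `Sketch`, stub `stub_klSectorKernel`.

For `ε₀ = squareDispersion 1 0`, `μ ∈ (-4, 0)`, `σ = fermiCurveMeasure ε₀ μ` (finite and `D₄`-invariant)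
and `χ₀ = lindhardFunction ε₀ μ` (with `(k, k') ↦ χ₀(k + k')` in `L²(σ ⊗ σ)`, `stub_klKernelHS`), let
`A` be a bounded operator on `L²(σ)` acting a.e. by the kernel `χ₀(k + k')` and `P` a bounded operator
acting a.e. as the isotypic projection `d4Project χ` of an irrep `χ` of `D₄`.  We show:

* `A P` acts a.e. by the SECTOR KERNEL `K_χ(k, k') = d4Project χ (χ₀(k + ·)) k'
  = (dim χ / 8) ∑_g χ(g) χ₀(k + g k')`: move the average from `φ` to the kernel by the
  measure-preserving substitutions `k' ↦ g k'` and the symmetry `χ(g⁻¹) = χ(g)` of the (real)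
  character table of `D₄` (`kl_sk_integral_mul_avg`, `kl_sp_char_inv` of `…SectorProj`);
* a finite-rank operator `∑ c_m ⟨u_m, ·⟩ u_m` (`u_m ∈ L²`) acts by the kernel `∑ c_m u_m(k) u_m(k')`
  and is a positive form for `c_m ≥ 0`;
* the deflated kernel `K_χ - ∑ c_m u_m ⊗ u_m` is in `L²(σ ⊗ σ)` (`χ₀(k + g k')` is the `L²` kernel
  composed with the measure-preserving map `id × g` of `σ ⊗ σ`).

Everything is first proved for an abstract left action `T` of a finite group by measure-preserving
maps (section `Abstract`), then specialised to `T = d4Momentum` (`kl_du_d4Momentum_mul`).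
-/

noncomputable section

set_option linter.dupNamespace false

namespace Summit.HubbardSuperconductivity.HubbardSuperconductivity.Theorems

open MeasureTheory Literature.MathematicalPhysics.QuantumLattice
open scoped ENNReal

/-! ### Abstract part: a measure-preserving left action of a finite group -/

section Abstract

variable {α : Type*} [MeasurableSpace α] {ν : Measure α} {G : Type*} [Group G] [Fintype G]
  {T : G → α → α}

omit [Fintype G] in
/-- Substitution `y ↦ T g y`: `∫ f(y) φ(T g⁻¹ y) dν = ∫ f(T g y) φ(y) dν` for a left action `T` by
measure-preserving measurable bijections. [folklore] -/
theorem kl_sk_integral_mul_comp_inv (hT : ∀ g, MeasurePreserving (T g) ν ν)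
    (hmul : ∀ g h x, T (g * h) x = T g (T h x)) (hone : ∀ x, T 1 x = x)
    (f φ : α → ℝ) (g : G) :
    ∫ y, f y * φ (T g⁻¹ y) ∂ν = ∫ y, f (T g y) * φ y ∂ν := by
  have h : ∫ x, f (T g x) * φ (T g⁻¹ (T g x)) ∂ν = ∫ y, f y * φ (T g⁻¹ y) ∂ν :=
    (hT g).integral_comp (kl_du_measurableEmbedding hT hmul hone g) fun y => f y * φ (T g⁻¹ y)
  rw [← h]
  simp only [kl_du_inv_apply hmul hone]

/-- **Moving the isotypic average across `∫ f φ`.** For an inversion-invariant weight `c`,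
`∫ f(y) · (d ∑_g c(g) φ(T g y)) dν = ∫ (d ∑_g c(g) f(T g y)) · φ(y) dν` (`f, φ ∈ L²`; reindex
`g ↦ g⁻¹` and substitute `y ↦ T g y`). [folklore] -/
theorem kl_sk_integral_mul_avg (hT : ∀ g, MeasurePreserving (T g) ν ν)
    (hmul : ∀ g h x, T (g * h) x = T g (T h x)) (hone : ∀ x, T 1 x = x)
    {c : G → ℝ} (hc : ∀ g, c g⁻¹ = c g) (d : ℝ) {f φ : α → ℝ} (hf : MemLp f 2 ν)
    (hφ : MemLp φ 2 ν) :
    ∫ y, f y * (d * ∑ g, c g * φ (T g y)) ∂ν = ∫ y, (d * ∑ g, c g * f (T g y)) * φ y ∂ν := by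
  have h1 : ∀ g, Integrable (fun y => f y * φ (T g y)) ν := fun g =>
    hf.integrable_mul (hφ.comp_measurePreserving (hT g))
  have h2 : ∀ g, Integrable (fun y => f (T g y) * φ y) ν := fun g =>
    (hf.comp_measurePreserving (hT g)).integrable_mul hφ
  have e1 : ∫ y, f y * (d * ∑ g, c g * φ (T g y)) ∂ν = d * ∑ g, c g * ∫ y, f y * φ (T g y) ∂ν := by
    have : (fun y => f y * (d * ∑ g, c g * φ (T g y))) =
        fun y => d * ∑ g, c g * (f y * φ (T g y)) := by
      funext y
      simp only [Finset.mul_sum]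
      exact Finset.sum_congr rfl fun g _ => by ring
    rw [this, integral_const_mul, integral_finsetSum _ fun g _ => (h1 g).const_mul (c g)]
    simp only [integral_const_mul]
  have e2 : ∫ y, (d * ∑ g, c g * f (T g y)) * φ y ∂ν = d * ∑ g, c g * ∫ y, f (T g y) * φ y ∂ν := by
    have : (fun y => (d * ∑ g, c g * f (T g y)) * φ y) =
        fun y => d * ∑ g, c g * (f (T g y) * φ y) := by
      funext y
      simp only [Finset.mul_sum, Finset.sum_mul]
      exact Finset.sum_congr rfl fun g _ => by ring
    rw [this, integral_const_mul, integral_finsetSum _ fun g _ => (h2 g).const_mul (c g)]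
    simp only [integral_const_mul]
  rw [e1, e2, ← Equiv.sum_comp (Equiv.inv G) (fun g => c g * ∫ y, f y * φ (T g y) ∂ν)]
  congr 1
  refine Finset.sum_congr rfl fun g _ => ?_
  rw [Equiv.inv_apply, hc, kl_sk_integral_mul_comp_inv hT hmul hone f φ g]

/-- **The sector kernel.** If `A` acts a.e. by the `L²` kernel `K₀` and `P` acts a.e. as the average
`proj ψ x = d ∑_g c(g) ψ(T g x)`, then `A P` acts a.e. by the kernel `proj (K₀ x ·) y`. [folklore] -/
theorem kl_sk_mul_proj_ae [SFinite ν] (hT : ∀ g, MeasurePreserving (T g) ν ν)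
    (hmul : ∀ g h x, T (g * h) x = T g (T h x)) (hone : ∀ x, T 1 x = x)
    {c : G → ℝ} (hc : ∀ g, c g⁻¹ = c g) {d : ℝ} {proj : (α → ℝ) → α → ℝ}
    (hproj : ∀ ψ x, proj ψ x = d * ∑ g, c g * ψ (T g x))
    {K₀ : α → α → ℝ} (hK : MemLp (Function.uncurry K₀) 2 (ν.prod ν))
    {A P : Lp ℝ 2 ν →L[ℝ] Lp ℝ 2 ν}
    (hA : ∀ φ : Lp ℝ 2 ν, (A φ : α → ℝ) =ᵐ[ν] fun x => ∫ y, K₀ x y * φ y ∂ν)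
    (hP : ∀ φ : Lp ℝ 2 ν, (P φ : α → ℝ) =ᵐ[ν] fun x => proj φ x) (φ : Lp ℝ 2 ν) :
    ((A * P) φ : α → ℝ) =ᵐ[ν] fun x => ∫ y, proj (K₀ x) y * φ y ∂ν := by
  rw [mul_apply_eq_comp]
  filter_upwards [hA (P φ), Literature.Analysis.OperatorTheory.ae_memLp_l2Kernel_section hK]
    with x hx hsec
  rw [hx]
  calc ∫ y, K₀ x y * (P φ) y ∂ν = ∫ y, K₀ x y * (d * ∑ g, c g * φ (T g y)) ∂ν := by
        refine integral_congr_ae ?_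
        filter_upwards [hP φ] with y hy
        rw [hy, hproj]
    _ = ∫ y, (d * ∑ g, c g * K₀ x (T g y)) * φ y ∂ν :=
        kl_sk_integral_mul_avg hT hmul hone hc d hsec (Lp.memLp φ)
    _ = ∫ y, proj (K₀ x) y * φ y ∂ν := by simp only [hproj]

/-- A.e. value of a finite real combination of `L²` classes. [folklore] -/
theorem kl_sk_coeFn_sum_smul {ι : Type*} (s : Finset ι) (a : ι → ℝ) (f : ι → Lp ℝ 2 ν) :
    ((∑ i ∈ s, a i • f i : Lp ℝ 2 ν) : α → ℝ) =ᵐ[ν] fun x => ∑ i ∈ s, a i * (f i : α → ℝ) x := by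
  classical
  induction s using Finset.induction_on with
  | empty =>
    simp only [Finset.sum_empty]
    exact Lp.coeFn_zero ℝ 2 ν
  | insert i s hi ih =>
    rw [Finset.sum_insert hi]
    filter_upwards [Lp.coeFn_add (a i • f i) (∑ j ∈ s, a j • f j), Lp.coeFn_smul (a i) (f i), ih]
      with x h1 h2 h3
    rw [h1, Pi.add_apply, h2, Pi.smul_apply, h3, Finset.sum_insert hi, smul_eq_mul]

/-- The rank-one operator `⟨u, ·⟩ u` of `u ∈ L²` acts a.e. as `x ↦ (∫ u φ dν) u(x)`. [folklore] -/
theorem kl_sk_rankOne_ae {u : α → ℝ} (hu : MemLp u 2 ν) (φ : Lp ℝ 2 ν) :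
    (((innerSL ℝ (hu.toLp u)).smulRight (hu.toLp u)) φ : α → ℝ) =ᵐ[ν]
      fun x => (∫ y, u y * φ y ∂ν) * u x := by
  have hinner : inner ℝ (hu.toLp u) φ = ∫ y, u y * φ y ∂ν := by
    rw [Literature.Analysis.OperatorTheory.inner_eq_integral]
    refine integral_congr_ae ?_
    filter_upwards [hu.coeFn_toLp] with y hy
    rw [hy]
  rw [ContinuousLinearMap.smulRight_apply, innerSL_apply_apply, hinner]
  filter_upwards [Lp.coeFn_smul (∫ y, u y * φ y ∂ν) (hu.toLp u), hu.coeFn_toLp] with x hx hx'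
  rw [hx, Pi.smul_apply, hx', smul_eq_mul]

/-- **Kernel of a finite-rank deflation**: `∑ c_m ⟨u_m, ·⟩ u_m` (`u_m ∈ L²`) acts a.e. by the kernel
`∑ c_m u_m(x) u_m(y)`. [folklore] -/
theorem kl_sk_finiteRank_ae {M : ℕ} (cm : Fin M → ℝ) {u : Fin M → α → ℝ}
    (hu : ∀ m, MemLp (u m) 2 ν) (φ : Lp ℝ 2 ν) :
    ((∑ m, cm m • (innerSL ℝ ((hu m).toLp (u m))).smulRight ((hu m).toLp (u m))) φ : α → ℝ) =ᵐ[ν]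
      fun x => ∫ y, (∑ m, cm m * (u m x * u m y)) * φ y ∂ν := by
  have hint : ∀ m, Integrable (fun y => u m y * φ y) ν := fun m =>
    (hu m).integrable_mul (Lp.memLp φ)
  have hI : ∀ x, ∫ y, (∑ m, cm m * (u m x * u m y)) * φ y ∂ν =
      ∑ m, cm m * ((∫ y, u m y * φ y ∂ν) * u m x) := by
    intro x
    have : (fun y => (∑ m, cm m * (u m x * u m y)) * φ y) =
        fun y => ∑ m, (cm m * u m x) * (u m y * φ y) := by
      funext y
      rw [Finset.sum_mul]
      exact Finset.sum_congr rfl fun m _ => by ring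
    rw [this, integral_finsetSum _ fun m _ => (hint m).const_mul _]
    exact Finset.sum_congr rfl fun m _ => by rw [integral_const_mul]; ring
  rw [sum_apply]
  simp only [smul_apply]
  filter_upwards [kl_sk_coeFn_sum_smul Finset.univ cm
      fun m => ((innerSL ℝ ((hu m).toLp (u m))).smulRight ((hu m).toLp (u m))) φ,
    Filter.eventually_all.2 fun m => kl_sk_rankOne_ae (hu m) φ] with x hx hx'
  rw [hx, hI]
  exact Finset.sum_congr rfl fun m _ => by rw [hx' m]

/-- **Positivity of the deflation**: `⟨φ, ∑ c_m ⟨v_m, φ⟩ v_m⟩ = ∑ c_m ⟨v_m, φ⟩² ≥ 0` for `c_m ≥ 0`.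
[folklore] -/
theorem kl_sk_finiteRank_nonneg {E : Type*} [NormedAddCommGroup E] [InnerProductSpace ℝ E]
    {M : ℕ} {cm : Fin M → ℝ} (hc : ∀ m, 0 ≤ cm m) (v : Fin M → E) (φ : E) :
    0 ≤ inner ℝ φ ((∑ m, cm m • (innerSL ℝ (v m)).smulRight (v m)) φ) := by
  rw [sum_apply, inner_sum]
  refine Finset.sum_nonneg fun m _ => ?_
  rw [smul_apply, ContinuousLinearMap.smulRight_apply, innerSL_apply_apply,
    real_inner_smul_right, real_inner_smul_right, real_inner_comm]
  exact mul_nonneg (hc m) (mul_self_nonneg _)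

/-- **Kernel of the deflated sector operator**: `A P - ∑ c_m ⟨u_m, ·⟩ u_m` acts a.e. by the kernel
`proj (K₀ x ·) y - ∑ c_m u_m(x) u_m(y)`. [folklore] -/
theorem kl_sk_kernel_ae [SFinite ν] (hT : ∀ g, MeasurePreserving (T g) ν ν)
    (hmul : ∀ g h x, T (g * h) x = T g (T h x)) (hone : ∀ x, T 1 x = x)
    {c : G → ℝ} (hc : ∀ g, c g⁻¹ = c g) {d : ℝ} {proj : (α → ℝ) → α → ℝ}
    (hproj : ∀ ψ x, proj ψ x = d * ∑ g, c g * ψ (T g x))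
    {K₀ : α → α → ℝ} (hK : MemLp (Function.uncurry K₀) 2 (ν.prod ν))
    {A P : Lp ℝ 2 ν →L[ℝ] Lp ℝ 2 ν}
    (hA : ∀ φ : Lp ℝ 2 ν, (A φ : α → ℝ) =ᵐ[ν] fun x => ∫ y, K₀ x y * φ y ∂ν)
    (hP : ∀ φ : Lp ℝ 2 ν, (P φ : α → ℝ) =ᵐ[ν] fun x => proj φ x)
    {M : ℕ} (cm : Fin M → ℝ) {u : Fin M → α → ℝ} (hu : ∀ m, MemLp (u m) 2 ν) (φ : Lp ℝ 2 ν) :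
    ((A * P - ∑ m, cm m • (innerSL ℝ ((hu m).toLp (u m))).smulRight ((hu m).toLp (u m))) φ : α → ℝ)
      =ᵐ[ν] fun x => ∫ y, (proj (K₀ x) y - ∑ m, cm m * (u m x * u m y)) * φ y ∂ν := by
  rw [sub_apply]
  filter_upwards [Lp.coeFn_sub ((A * P) φ)
      ((∑ m, cm m • (innerSL ℝ ((hu m).toLp (u m))).smulRight ((hu m).toLp (u m))) φ),
    kl_sk_mul_proj_ae hT hmul hone hc hproj hK hA hP φ, kl_sk_finiteRank_ae cm hu φ,
    Literature.Analysis.OperatorTheory.ae_memLp_l2Kernel_section hK] with x h1 h2 h3 hsec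
  rw [h1, Pi.sub_apply, h2, h3]
  have i1 : Integrable (fun y => proj (K₀ x) y * φ y) ν := by
    have hm : MemLp (fun y => proj (K₀ x) y) 2 ν := by
      simp only [hproj]
      exact (memLp_finsetSum _ fun g _ =>
        ((hsec.comp_measurePreserving (hT g)).const_mul (c g))).const_mul d
    exact hm.integrable_mul (Lp.memLp φ)
  have i2 : Integrable (fun y => (∑ m, cm m * (u m x * u m y)) * φ y) ν := by
    have : (fun y => (∑ m, cm m * (u m x * u m y)) * φ y) =
        fun y => ∑ m, (cm m * u m x) * (u m y * φ y) := by
      funext y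
      rw [Finset.sum_mul]
      exact Finset.sum_congr rfl fun m _ => by ring
    rw [this]
    exact integrable_finsetSum _ fun m _ => ((hu m).integrable_mul (Lp.memLp φ)).const_mul _
  rw [← integral_sub i1 i2]
  refine integral_congr_ae (ae_of_all _ fun y => ?_)
  simp only [sub_mul]

omit [Group G] in
/-- **Square integrability of the deflated sector kernel**: `proj (K₀ x ·) y - ∑ c_m u_m(x) u_m(y)`
is in `L²(ν ⊗ ν)` (`K₀ ∘ (id × T g)` is `L²` by invariance of `ν`, `u_m ⊗ u_m ∈ L²`). [folklore] -/
theorem kl_sk_kernel_memLp [SFinite ν] (hT : ∀ g, MeasurePreserving (T g) ν ν) {c : G → ℝ} {d : ℝ}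
    {proj : (α → ℝ) → α → ℝ} (hproj : ∀ ψ x, proj ψ x = d * ∑ g, c g * ψ (T g x))
    {K₀ : α → α → ℝ} (hK : MemLp (Function.uncurry K₀) 2 (ν.prod ν))
    {M : ℕ} (cm : Fin M → ℝ) {u : Fin M → α → ℝ} (hu : ∀ m, MemLp (u m) 2 ν) :
    MemLp (Function.uncurry fun x y => proj (K₀ x) y - ∑ m, cm m * (u m x * u m y)) 2 (ν.prod ν) := by
  have hg : ∀ g, MemLp (fun z : α × α => K₀ z.1 (T g z.2)) 2 (ν.prod ν) := fun g =>
    hK.comp_measurePreserving ((MeasurePreserving.id ν).prod (hT g))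
  have h1 : MemLp (fun z : α × α => proj (K₀ z.1) z.2) 2 (ν.prod ν) := by
    simp only [hproj]
    exact (memLp_finsetSum _ fun g _ => (hg g).const_mul (c g)).const_mul d
  exact h1.sub (memLp_finsetSum _ fun m _ =>
    (Literature.Analysis.OperatorTheory.memLp_two_tensor_of_memLp (hu m) (hu m)).const_mul (cm m))

end Abstract

/-! ### The stub -/

/-- **Sector kernels.** For `μ ∈ (-4,0)`, an operator `A` given a.e. by the kernel `χ₀(k+k')` and an operator `P` acting a.e.
as the isotypic projection `d4Project χ`: the product `A * P` is given a.e. by the SECTOR KERNEL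
`K_χ(k,k') = d4Project χ (χ₀(k + ·)) k' = (dim χ/8) Σ_g χ(g) χ₀(k + g k')`, which is square integrable on `σ ⊗ σ`; a finite
rank `Σ_m c_m ⟨u_m, ·⟩ u_m` (`u_m ∈ L²`) is given by the kernel `Σ_m c_m u_m(k) u_m(k')`, is a positive form for `c_m ≥ 0`,
and the difference kernel is again square integrable. [folklore] -/
theorem stub_klSectorKernel : ∀ μ ∈ Set.Ioo (-4 : ℝ) 0, ∀ (χ : D4Irrep)
    (A P : Lp ℝ 2 (fermiCurveMeasure (squareDispersion 1 0) μ) →L[ℝ] Lp ℝ 2 (fermiCurveMeasure (squareDispersion 1 0) μ)),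
    (∀ φ : Lp ℝ 2 (fermiCurveMeasure (squareDispersion 1 0) μ),
      (A φ : Momentum → ℝ) =ᵐ[fermiCurveMeasure (squareDispersion 1 0) μ]
        fun k => ∫ k', lindhardFunction (squareDispersion 1 0) μ (k + k') * φ k'
          ∂fermiCurveMeasure (squareDispersion 1 0) μ) →
    (∀ φ : Lp ℝ 2 (fermiCurveMeasure (squareDispersion 1 0) μ),
      (P φ : Momentum → ℝ) =ᵐ[fermiCurveMeasure (squareDispersion 1 0) μ] fun k => d4Project χ φ k) →
    ∀ (M : ℕ) (c : Fin M → ℝ) (u : Fin M → Momentum → ℝ)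
      (hu : ∀ m, MemLp (u m) 2 (fermiCurveMeasure (squareDispersion 1 0) μ)),
    MemLp (Function.uncurry fun k k' : Momentum =>
        d4Project χ (fun q => lindhardFunction (squareDispersion 1 0) μ (k + q)) k' - ∑ m, c m * (u m k * u m k')) 2
      ((fermiCurveMeasure (squareDispersion 1 0) μ).prod (fermiCurveMeasure (squareDispersion 1 0) μ)) ∧
    (∀ φ : Lp ℝ 2 (fermiCurveMeasure (squareDispersion 1 0) μ),
      ((A * P - ∑ m, c m • (innerSL ℝ ((hu m).toLp (u m))).smulRight ((hu m).toLp (u m))) φ : Momentum → ℝ)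
        =ᵐ[fermiCurveMeasure (squareDispersion 1 0) μ]
        fun k => ∫ k', (d4Project χ (fun q => lindhardFunction (squareDispersion 1 0) μ (k + q)) k' -
            ∑ m, c m * (u m k * u m k')) * φ k' ∂fermiCurveMeasure (squareDispersion 1 0) μ) ∧
    ((∀ m, 0 ≤ c m) → ∀ φ : Lp ℝ 2 (fermiCurveMeasure (squareDispersion 1 0) μ),
      0 ≤ inner ℝ φ ((∑ m, c m • (innerSL ℝ ((hu m).toLp (u m))).smulRight ((hu m).toLp (u m))) φ)) := by
  intro μ hμ χ A P hA hP M c u hu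
  haveI : IsFiniteMeasure (fermiCurveMeasure (squareDispersion 1 0) μ) :=
    stub_klFiniteMeasure stub_klGradient stub_klHausdorffFinite μ hμ
  have hT : ∀ g : DihedralGroup 4, MeasurePreserving (d4Momentum g)
      (fermiCurveMeasure (squareDispersion 1 0) μ) (fermiCurveMeasure (squareDispersion 1 0) μ) :=
    stub_klD4Invariant stub_klGradient μ hμ
  have hK : MemLp (Function.uncurry fun k k' : Momentum => lindhardFunction (squareDispersion 1 0) μ (k + k')) 2
      ((fermiCurveMeasure (squareDispersion 1 0) μ).prod (fermiCurveMeasure (squareDispersion 1 0) μ)) :=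
    stub_klKernelHS μ hμ
  have hproj : ∀ (ψ : Momentum → ℝ) (k : Momentum),
      d4Project χ ψ k = (χ.dim / 8 : ℝ) * ∑ g, χ.char g * ψ (d4Momentum g k) := fun _ _ => rfl
  exact ⟨kl_sk_kernel_memLp hT hproj hK c hu,
    fun φ => kl_sk_kernel_ae hT kl_du_d4Momentum_mul d4Momentum_one (kl_sp_char_inv χ) hproj hK hA hP c hu φ,
    fun hc φ => kl_sk_finiteRank_nonneg hc _ φ⟩

end Summit.HubbardSuperconductivity.HubbardSuperconductivity.Theorems

end
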